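import Summits.AtomisticToContinuum.BoseEinsteinCondensation.Theorems.BECInsertionCorrectorCorrectorClosureFirstCorrectorBoundFourier
import Summits.AtomisticToContinuum.BoseEinsteinCondensation.Theorems.BECInsertionCorrectorCorrectorClosureFirstCorrectorBoundModes
import Literature.MathematicalPhysics.QuantumManyBody.PeriodicBoseGasImpurityTranslation
import Literature.MathematicalPhysics.QuantumManyBody.PeriodicBoseGasTagged
import HarnessLib

/-!
# Crux `CorrectorClosure` (stmt-AtomisticToContinuum-12058), line `residue-area-law` —
# stub `stub_firstCorrectorBound`, auxiliary file 4: the centred impurity coupling, modes + error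

Supports (does not close) stmt-AtomisticToContinuum-12058, route `BECInsertionCorrector`.
Theorems only. For a measurable profile `v` with bounded periodisation `v^per ≤ C_U` on the torus
of side `L > 0`, with `U = (v^per).toReal` (bounded measurable, `Lℤ³`-periodic, even) and
`ĉ_k = cellFourierCoeff L U k`:
* bookkeeping for `U`: bounds, periodicity, `∫_{[0,L)³} U = ∫_{ℝ³} v =: κ`, `∫ U² ≤ C_U κ`,
  `Re ĉ₀ = L⁻³κ`, `(∑ⱼ v^per(xⱼ - y)).toReal = ∑ⱼ U(y - xⱼ)`, measurability and the bound
  `|∑ⱼ U(y - xⱼ) - N L⁻³κ| ≤ N C_U + N L⁻³ κ`;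
* `sum_translate_re_partialSum` — the bath sum of translated real partial Fourier sums of a real
  `U` is a tagged-mode sum: `∑ⱼ Re S_K U (y - xⱼ) = N Re ĉ₀ + ∑_{k ∈ S} (a_k(X')cos(p_k·y) + b_k(X')sin(p_k·y))`,
  `a_k = 2(Re ĉ_k ∑ⱼcos(p_k·xⱼ) + Im ĉ_k ∑ⱼsin(p_k·xⱼ))`, `b_k = 2(Re ĉ_k ∑ⱼsin - Im ĉ_k ∑ⱼcos)`, for
  every index set `S` folding the cube (`ĉ₋ₖ = conj ĉ_k`);
* **the decomposition** `centredImpurity_eq_modes_add_err`: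
  `∑ⱼ v^per(xⱼ - y) - N L⁻³ ∫v = [tagged-mode sum over S] + ∑ⱼ (U - Re S_K U)(y - xⱼ)` for every `K`.
-/

noncomputable section

open MeasureTheory Filter Matrix
open scoped ENNReal NNReal BigOperators ComplexConjugate

namespace Summit.AtomisticToContinuum.BoseEinsteinCondensation.Theorems.CorrectorClosure.ResidueAreaLaw

open Literature.MathematicalPhysics.QuantumManyBody.BoseGas

variable {N : ℕ} {L : ℝ} {v : ℝ → ℝ≥0∞}

/-! ### The periodised potential as a bounded measurable periodic real function -/

/-- `U = (v^per).toReal` is measurable. [folklore] -/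
theorem measurable_toReal_periodizedPotential (hv : Measurable v) (L : ℝ) :
    Measurable fun z => (periodizedPotential v L z).toReal :=
  (measurable_periodizedPotential hv L).ennreal_toReal

/-- `U ≤ C_U`. [folklore] -/
theorem toReal_periodizedPotential_le {CU : ℝ≥0} (hCU : ∀ x, periodizedPotential v L x ≤ CU)
    (z : Space) : (periodizedPotential v L z).toReal ≤ CU := by
  rw [← ENNReal.coe_toReal (r := CU)]
  exact ENNReal.toReal_mono ENNReal.coe_ne_top (hCU z)

/-- `|U| ≤ C_U`. [folklore] -/
theorem abs_toReal_periodizedPotential_le {CU : ℝ≥0} (hCU : ∀ x, periodizedPotential v L x ≤ CU)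
    (z : Space) : |(periodizedPotential v L z).toReal| ≤ CU := by
  rw [abs_of_nonneg ENNReal.toReal_nonneg]; exact toReal_periodizedPotential_le hCU z

/-- `‖(U : ℂ)‖ ≤ C_U`. [folklore] -/
theorem norm_toReal_periodizedPotential_le {CU : ℝ≥0} (hCU : ∀ x, periodizedPotential v L x ≤ CU)
    (z : Space) : ‖(((periodizedPotential v L z).toReal : ℝ) : ℂ)‖ ≤ CU := by
  rw [Complex.norm_real, Real.norm_eq_abs]; exact abs_toReal_periodizedPotential_le hCU z

/-- `U` is `Lℤ³`-periodic. [folklore] -/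
theorem toReal_periodizedPotential_periodic (v : ℝ → ℝ≥0∞) (L : ℝ) (z : Space) (k : Fin 3) :
    (periodizedPotential v L (z + EuclideanSpace.single k L)).toReal = (periodizedPotential v L z).toReal := by
  rw [← latticeVec_single, periodizedPotential_add_latticeVec]

/-- **The cell integral of `U`**: `∫_{[0,L)³} U = ∫_{ℝ³} v` (as real numbers). [folklore] -/
theorem integral_cell_toReal_periodizedPotential (hL : 0 < L) (hv : Measurable v) {CU : ℝ≥0}
    (hCU : ∀ x, periodizedPotential v L x ≤ CU) :
    ∫ z in cell L, (periodizedPotential v L z).toReal = (∫⁻ x : Space, v ‖x‖).toReal := by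
  rw [integral_toReal (measurable_periodizedPotential hv L).aemeasurable
    (Eventually.of_forall fun z => (hCU z).trans_lt ENNReal.coe_lt_top)]
  congr 1
  have h := lintegral_cell_periodizedPotential_sub hL hv 0
  simp only [sub_zero] at h
  exact h

/-- `∫_{[0,L)³} ‖(U : ℂ)‖ = ∫_{ℝ³} v`. [folklore] -/
theorem integral_cell_norm_toReal_periodizedPotential (hL : 0 < L) (hv : Measurable v) {CU : ℝ≥0}
    (hCU : ∀ x, periodizedPotential v L x ≤ CU) :
    ∫ z in cell L, ‖(((periodizedPotential v L z).toReal : ℝ) : ℂ)‖ = (∫⁻ x : Space, v ‖x‖).toReal := by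
  rw [← integral_cell_toReal_periodizedPotential hL hv hCU]
  refine integral_congr_ae (Eventually.of_forall fun z => ?_)
  show ‖(((periodizedPotential v L z).toReal : ℝ) : ℂ)‖ = (periodizedPotential v L z).toReal
  rw [Complex.norm_real, Real.norm_eq_abs, abs_of_nonneg ENNReal.toReal_nonneg]

/-- `∫_{[0,L)³} ‖(U : ℂ)‖² ≤ C_U · ∫_{ℝ³} v`. [folklore] -/
theorem integral_cell_sq_toReal_periodizedPotential_le (hL : 0 < L) (hv : Measurable v) {CU : ℝ≥0}
    (hCU : ∀ x, periodizedPotential v L x ≤ CU) :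
    ∫ z in cell L, ‖(((periodizedPotential v L z).toReal : ℝ) : ℂ)‖ ^ 2 ≤
      CU * (∫⁻ x : Space, v ‖x‖).toReal := by
  rw [← integral_cell_toReal_periodizedPotential hL hv hCU, ← integral_const_mul]
  have hint : IntegrableOn (fun z => (periodizedPotential v L z).toReal) (cell L) volume :=
    Measure.integrableOn_of_bounded (by rw [volume_cell]; exact ENNReal.pow_ne_top ENNReal.ofReal_ne_top)
      (measurable_toReal_periodizedPotential hv L).aestronglyMeasurable
      (Eventually.of_forall fun z => by
        rw [Real.norm_eq_abs]; exact abs_toReal_periodizedPotential_le hCU z)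
  refine integral_mono_of_nonneg (Eventually.of_forall fun z => by positivity) (hint.const_mul _)
    (Eventually.of_forall fun z => ?_)
  show ‖(((periodizedPotential v L z).toReal : ℝ) : ℂ)‖ ^ 2 ≤ CU * (periodizedPotential v L z).toReal
  rw [Complex.norm_real, Real.norm_eq_abs, sq_abs, sq]
  exact mul_le_mul_of_nonneg_right (toReal_periodizedPotential_le hCU z) ENNReal.toReal_nonneg

/-- `Re ĉ₀(U) = L⁻³ ∫_{ℝ³} v`. [folklore] -/
theorem re_cellFourierCoeff_periodizedPotential_zero (hL : 0 < L) (hv : Measurable v) {CU : ℝ≥0}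
    (hCU : ∀ x, periodizedPotential v L x ≤ CU) :
    (cellFourierCoeff L (fun z => (((periodizedPotential v L z).toReal : ℝ) : ℂ)) 0).re =
      (L ^ 3)⁻¹ * (∫⁻ x : Space, v ‖x‖).toReal := by
  rw [re_cellFourierCoeff_zero_of_real hL, integral_cell_toReal_periodizedPotential hL hv hCU]

/-! ### The impurity coupling as a real sum -/

/-- The impurity coupling as a real sum: `(∑ⱼ v^per(xⱼ - y)).toReal = ∑ⱼ U(y - xⱼ)` (`v^per` is
even). [folklore] -/
theorem toReal_impurityInteraction {CU : ℝ≥0} (hCU : ∀ x, periodizedPotential v L x ≤ CU)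
    (y : Space) (Z : Config N) :
    (impurityInteraction v L y Z).toReal = ∑ j, (periodizedPotential v L (y - Z j)).toReal := by
  unfold impurityInteraction
  rw [ENNReal.toReal_sum fun j _ => ((hCU _).trans_lt ENNReal.coe_lt_top).ne]
  exact Finset.sum_congr rfl fun j _ => by rw [periodizedPotential_sub_comm]

/-- The impurity coupling `X ↦ (∑ⱼ v^per(xⱼ - y)).toReal` on the `(N+1)`-torus is measurable.
[folklore] -/
theorem measurable_toReal_impurityInteraction (hv : Measurable v) (L : ℝ) :
    Measurable fun X : Config (N + 1) => (impurityInteraction v L (X 0) (vecTail X)).toReal := by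
  refine Measurable.ennreal_toReal ?_
  unfold impurityInteraction
  refine Finset.measurable_sum _ fun j _ => ?_
  exact (measurable_periodizedPotential hv L).comp
    ((measurable_pi_apply j.succ).sub (measurable_pi_apply 0))

/-- `(∑ⱼ v^per(xⱼ - y)).toReal ≤ N C_U`. [folklore] -/
theorem toReal_impurityInteraction_le {CU : ℝ≥0} (hCU : ∀ x, periodizedPotential v L x ≤ CU)
    (y : Space) (Z : Config N) :
    (impurityInteraction v L y Z).toReal ≤ N * CU := by
  rw [toReal_impurityInteraction hCU]
  calc ∑ j, (periodizedPotential v L (y - Z j)).toReal ≤ ∑ _j : Fin N, (CU : ℝ) :=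
        Finset.sum_le_sum fun j _ => toReal_periodizedPotential_le hCU _
    _ = N * CU := by simp

/-- **The centred impurity coupling is bounded**: `|∑ⱼ v^per(xⱼ - y) - N L⁻³∫v| ≤ N C_U + N L⁻³ ∫v`
(`L > 0`). [folklore] -/
theorem abs_centredImpurity_le (hL : 0 < L) {CU : ℝ≥0} (hCU : ∀ x, periodizedPotential v L x ≤ CU)
    (X : Config (N + 1)) :
    |(impurityInteraction v L (X 0) (vecTail X)).toReal -
        (N : ℝ) / L ^ 3 * (∫⁻ x : Space, v ‖x‖).toReal| ≤
      N * CU + (N : ℝ) / L ^ 3 * (∫⁻ x : Space, v ‖x‖).toReal := by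
  have h0 : 0 ≤ (impurityInteraction v L (X 0) (vecTail X)).toReal := ENNReal.toReal_nonneg
  have h1 := toReal_impurityInteraction_le hCU (X 0) (vecTail X)
  have h2 : 0 ≤ (N : ℝ) / L ^ 3 * (∫⁻ x : Space, v ‖x‖).toReal := by positivity
  rw [abs_le]
  constructor <;> linarith

/-! ### The bath sum of translated real partial Fourier sums is a tagged-mode sum -/

/-- **Translated real partial sums as tagged modes.** For a real `U` with cell Fourier coefficients
`ĉ_k` and an index set `S` folding the cube `{-K,…,K}³`:
`∑ⱼ Re S_K U (y - xⱼ) = N Re ĉ₀ + ∑_{k ∈ S} (a_k(X') cos(p_k·y) + b_k(X') sin(p_k·y))` with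
`a_k = 2(Re ĉ_k ∑ⱼcos(p_k·xⱼ) + Im ĉ_k ∑ⱼ sin(p_k·xⱼ))`, `b_k = 2(Re ĉ_k ∑ⱼ sin(p_k·xⱼ) - Im ĉ_k ∑ⱼcos(p_k·xⱼ))`
(`ĉ₋ₖ = conj ĉ_k` since `U` is real). [folklore] -/
theorem sum_translate_re_partialSum (hL : 0 < L) (U : Space → ℝ) {S : Finset (Fin 3 → ℤ)} {K : ℕ}
    (hfold : ∀ f : (Fin 3 → ℤ) → ℝ, ∑ k ∈ Finset.Icc (-(K : Fin 3 → ℤ)) (K : Fin 3 → ℤ), f k =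
      f 0 + ∑ k ∈ S, (f k + f (-k))) (Z : Config N) (y : Space) :
    ∑ j : Fin N, (partialSum L (fun z => (U z : ℂ)) K (y - Z j)).re =
      N * (cellFourierCoeff L (fun z => (U z : ℂ)) 0).re + ∑ k ∈ S,
        (2 * ((cellFourierCoeff L (fun z => (U z : ℂ)) k).re *
                ∑ j, Real.cos (2 * Real.pi / L * ∑ i, (k i : ℝ) * Z j i) +
              (cellFourierCoeff L (fun z => (U z : ℂ)) k).im *
                ∑ j, Real.sin (2 * Real.pi / L * ∑ i, (k i : ℝ) * Z j i)) *
            Real.cos (2 * Real.pi / L * ∑ i, (k i : ℝ) * y i) +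
          2 * ((cellFourierCoeff L (fun z => (U z : ℂ)) k).re *
                ∑ j, Real.sin (2 * Real.pi / L * ∑ i, (k i : ℝ) * Z j i) -
              (cellFourierCoeff L (fun z => (U z : ℂ)) k).im *
                ∑ j, Real.cos (2 * Real.pi / L * ∑ i, (k i : ℝ) * Z j i)) *
            Real.sin (2 * Real.pi / L * ∑ i, (k i : ℝ) * y i)) := by
  simp only [re_partialSum_eq_sum]
  exact sum_translate_trigPoly_eq_modes L hfold (fun k => (cellFourierCoeff L (fun z => (U z : ℂ)) k).re)
    (fun k => (cellFourierCoeff L (fun z => (U z : ℂ)) k).im)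
    (fun k => by simp only [cellFourierCoeff_neg_of_real hL, Complex.conj_re])
    (fun k => by simp only [cellFourierCoeff_neg_of_real hL, Complex.conj_im]) Z y

/-- **The decomposition of the centred impurity coupling.** With `U = (v^per).toReal`, its cell
Fourier coefficients `ĉ_k`, an index set `S` folding the cube `{-K,…,K}³`, and `y = X 0`,
`X' = vecTail X`:
`(∑ⱼ v^per(xⱼ - y)).toReal - N L⁻³ ∫v = ∑_{k ∈ S} (a_k(X') cos(p_k·y) + b_k(X') sin(p_k·y))
  + ∑ⱼ (U(y - xⱼ) - Re S_K U (y - xⱼ))` (evenness of `v^per`, `Re ĉ₀ = L⁻³∫v`). [folklore] -/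
theorem centredImpurity_eq_modes_add_err (hL : 0 < L) (hv : Measurable v) {CU : ℝ≥0}
    (hCU : ∀ x, periodizedPotential v L x ≤ CU) {S : Finset (Fin 3 → ℤ)} {K : ℕ}
    (hfold : ∀ f : (Fin 3 → ℤ) → ℝ, ∑ k ∈ Finset.Icc (-(K : Fin 3 → ℤ)) (K : Fin 3 → ℤ), f k =
      f 0 + ∑ k ∈ S, (f k + f (-k))) (X : Config (N + 1)) :
    (impurityInteraction v L (X 0) (vecTail X)).toReal -
        (N : ℝ) / L ^ 3 * (∫⁻ x : Space, v ‖x‖).toReal =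
      (∑ k ∈ S,
        (2 * ((cellFourierCoeff L (fun z => (((periodizedPotential v L z).toReal : ℝ) : ℂ)) k).re *
                ∑ j, Real.cos (2 * Real.pi / L * ∑ i, (k i : ℝ) * vecTail X j i) +
              (cellFourierCoeff L (fun z => (((periodizedPotential v L z).toReal : ℝ) : ℂ)) k).im *
                ∑ j, Real.sin (2 * Real.pi / L * ∑ i, (k i : ℝ) * vecTail X j i)) *
            Real.cos (2 * Real.pi / L * ∑ i, (k i : ℝ) * X 0 i) +
          2 * ((cellFourierCoeff L (fun z => (((periodizedPotential v L z).toReal : ℝ) : ℂ)) k).re *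
                ∑ j, Real.sin (2 * Real.pi / L * ∑ i, (k i : ℝ) * vecTail X j i) -
              (cellFourierCoeff L (fun z => (((periodizedPotential v L z).toReal : ℝ) : ℂ)) k).im *
                ∑ j, Real.cos (2 * Real.pi / L * ∑ i, (k i : ℝ) * vecTail X j i)) *
            Real.sin (2 * Real.pi / L * ∑ i, (k i : ℝ) * X 0 i))) +
      ∑ j : Fin N, ((periodizedPotential v L (X 0 - vecTail X j)).toReal -
        (partialSum L (fun z => (((periodizedPotential v L z).toReal : ℝ) : ℂ)) K (X 0 - vecTail X j)).re) := by
  have hre := sum_translate_re_partialSum (N := N) hL (fun z => (periodizedPotential v L z).toReal)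
    hfold (vecTail X) (X 0)
  rw [toReal_impurityInteraction hCU, Finset.sum_sub_distrib, hre,
    re_cellFourierCoeff_periodizedPotential_zero hL hv hCU]
  field_simp
  ring

end Summit.AtomisticToContinuum.BoseEinsteinCondensation.Theorems.CorrectorClosure.ResidueAreaLaw

end
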